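import Summits.CriticalPhenomena.Ising3DConformalLimit.Theorems.PrecisionLaplacianInverseMFerromagnetLaw2FourMtp2
import Summits.CriticalPhenomena.Ising3DConformalLimit.Theorems.PrecisionLaplacianInverseMFerromagnetMarginalFourMtp2
import Summits.CriticalPhenomena.Ising3DConformalLimit.Theorems.PrecisionLaplacianInverseMFerromagnetLaw2FourVisible
import HarnessLib

/-!
# `Law₂` on four VISIBLE sites of an arbitrary zero-field pair ferromagnet (crux `InverseMFerromagnet`, line `Sketch`, lead c8)

Assembly of the three landed level-4 Gram stubs of skeleton v20 (crux FINDINGS-c8, L1):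
* G1 `helper_law2_four_mtp2` (module …Law2FourMtp2): `Law₂` on `{±1}⁴` for every positive, even weight with the
  FKG lattice condition (odd-Gram duality with the dual weight `1/ν` + the antiferromagnetic level-2 sign);
* G2 `helper_marginal_four_mtp2` (module …MarginalFourMtp2): the four-site marginal of a pair ferromagnet is positive,
  even and FKG-lattice (Ahlswede–Daykin / Karlin–Rinott closure of MTP₂ under marginals);
* G3 `helper_law2_fourVisible_of` (module …Law2FourVisible): the glue to the `n`-site correlations.

Consequence recorded here: for every zero-field pair ferromagnet on `Fin n`, every site embedding `e : Fin 4 ↪ Fin n`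
and all 3-sets `A, B ⊆ Fin 4`, the partial covariance of the cubics `σ_{e(A)}`, `σ_{e(B)}` given the LINEAR span of the
four visible spins `σ_{e 0}, …, σ_{e 3}` is nonnegative — `Law₂` with arbitrarily many HIDDEN spins at four visible sites
(c1's conjecture "OddLaw-visible" at `|T| = 4`), extending `helper_law2_four` (pair ferromagnets ON four sites, p129163).
In the level-4 anatomy `PCov(x,y | lin σ_S) = E[Cov(σ_x,σ_y | σ_S)] + κ^{xᵀ}G_Sκ^y` (`|S| = 4`) this settles `G_S ≥ 0`
entrywise; the remaining cone law for realizable cubic vectors `κ` is open (FINDINGS-c8 L2).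
-/

namespace Summit.CriticalPhenomena.Ising3DConformalLimit.Cruxes.InverseMFerromagnet.PartialCovarianceLadder

open Literature.Probability.LatticeModels Finset Matrix

noncomputable section

/-- **`helper_law2_fourVisible` — `Law₂` on four visible sites of any zero-field pair ferromagnet** (registered stub of
crux stmt-CriticalPhenomena-4798, line `Sketch`, skeleton v20): for `K ≥ 0`, `|C i| = 2`, `e : Fin 4 ↪ Fin n` and 3-sets
`A, B ⊆ Fin 4`, `v_{e(A)}ᵀ (Σ|_{e(Fin 4)})⁻¹ v_{e(B)} ≤ ⟨σ_{e(A)}σ_{e(B)}⟩` with `v_{e(A)}(w) = ⟨σ_{e(A)}σ_{e(w)}⟩`.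
One-line assembly of G1–G3. [folklore] -/
theorem helper_law2_fourVisible :
    ∀ (n m : ℕ) (K : Fin m → ℝ) (C : Fin m → Finset (Fin n)), (∀ i, 0 ≤ K i) → (∀ i, (C i).card = 2) →
      ∀ (e : Fin 4 ↪ Fin n) (A B : Finset (Fin 4)), A.card = 3 → B.card = 3 →
        dotProduct (fun w => gksExpect Finset.univ K C (fun ω => spinProduct (A.map e) ω * spinAt (e w) ω))
          (((Matrix.of fun p q : Fin 4 =>
              gksExpect Finset.univ K C (fun ω => spinAt (e p) ω * spinAt (e q) ω))⁻¹).mulVec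
            (fun w => gksExpect Finset.univ K C (fun ω => spinProduct (B.map e) ω * spinAt (e w) ω)))
        ≤ gksExpect Finset.univ K C (fun ω => spinProduct (A.map e) ω * spinProduct (B.map e) ω) :=
  helper_law2_fourVisible_of helper_law2_four_mtp2 helper_marginal_four_mtp2

end

end Summit.CriticalPhenomena.Ising3DConformalLimit.Cruxes.InverseMFerromagnet.PartialCovarianceLadder
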